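import Literature.Geometry.Lorentzian.CoordMetricVariation
import HarnessLib

/-!
# Evolution of the scalar curvature under the Ricci flow, in coordinates (Topping, Prop. 2.5.4)

Fourth layer of the coordinate tensor calculus (`CoordCurvature`, `CoordBianchi`,
`CoordMetricVariation`). For a smooth one-parameter family of metric components
`G : ℝ → E → (E →L E →L ℝ)` on `V × S` (`IsMetricFamilyOn G S V`) we first record the variation
of the scalar curvature in a basis `b` (Topping 2006, Prop. 2.3.6 applied to `Ric`):

  `∂_t S = Σ_{kl} (∂_t g^{kl}) Ric_{kl} + Σ_{kl} g^{kl} ∂_t Ric_{kl}`,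
  `∂_t Ric(Y,Z) = Σᵢ bⁱ((∂_t R)(bᵢ,Y)Z)`, `∂_t g^{kl} = bᵏ((−♯h♯) bˡ)`

(`hasDerivWithinAt_scalAt`), and then specialise to the **Ricci flow in coordinates**,
`h = ∂G/∂t = −2 Ric(G)` on `V × S`, where

* the first sum is `2 |Ric|²` (`sum_dginv_ricAt_eq`);
* the second is `ΔS`: writing `∂_t R(X,Y) = (∇_XΠ)(Y) − (∇_YΠ)(X)` (Prop. 2.3.4), the trace of
  the first term is the divergence of the vector `V = tr_G Π`, which **vanishes identically by the
  contracted Bianchi identity** (`G(V, Z) = 2 div Ric(Z) − dS(Z) = 0`, Prop. 2.3.1 with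
  `h = −2Ric` and `CoordBianchi.fderiv_scalAt`), while the second term traces to
  `tr_G ∇ω` with `ω = tr Π(·, Z) = ½ d(tr_G h) = −dS`, i.e. to `−tr_G Hess S = −ΔS`
  (this is Topping's route (2.3.15)–(2.3.17): `∂_t R = −⟨Ric,h⟩ + δ²h − Δ tr h` with
  `δ Ric = −½ dR`).

The outcome is **Topping 2006, Prop. 2.5.4 in coordinates**
(`IsMetricFamilyOn.hasDerivWithinAt_scalAt_ricciFlow`):

  `∂_t S = ΔS + 2 |Ric|²`  (derivative within `S`, valid up to the end points),

with `Δ f = tr_G Hess f`, `Hess f (Y,Z) = D²f(Y,Z) − Df(Γ(Y,Z))` (`lapAt`, `hessAt`; the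
coordinate Hessian of `OpensChart.hessianForm`) and `|Ric|² = normSqAt` (the definition of
`PseudoRiemannianMetric.normSq`). Everything is proved; no statement is assumed. The transport
to the abstract Ricci flow on a manifold is done in later files.

## References

* P. Topping, *Lectures on the Ricci flow*, LMS Lecture Note Series 325, CUP 2006: Prop. 2.3.1,
  2.3.4, 2.3.6, 2.3.9 and their proofs (§2.3.2, (2.3.14)–(2.3.17)), Prop. 2.5.4 (p. 33,
  `∂R/∂t = ΔR + 2|Ric|²`). [Topping2006]
* R. S. Hamilton, *Three-manifolds with positive Ricci curvature*, J. Differential Geom. 17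
  (1982), Cor. 7.5. [Hamilton1982]
* B. O'Neill, *Semi-Riemannian geometry with applications to relativity*, 1983, Ch. 3,
  Cor. 3.54 (`dS = 2 div Ric`), Def. 3.48–3.50 (Hessian, Laplacian). [ONeill1983]
-/

noncomputable section

set_option maxSynthPendingDepth 3

open Set Filter ContinuousLinearMap Module
open scoped Topology ContDiff

namespace Literature.Geometry.Lorentzian

namespace MetricCoord

variable {E : Type*} [NormedAddCommGroup E] [NormedSpace ℝ E]

/-! ### The coordinate Hessian and Laplacian -/

section Hessian

variable (G : E → E →L[ℝ] E →L[ℝ] ℝ)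

/-- The **coordinate Hessian** of `f : E → ℝ` for the components `G` at `x`:
`Hess f (Y, Z) = D²f(x)(Y,Z) − Df(x)(Γ(Y,Z))` (O'Neill 1983, Ch. 3, Def. 3.48–Lemma 3.49,
`H^f(Y,Z) = YZf − (∇_Y Z)f` on constant fields; the form `OpensChart.hessianForm`).
[cite: ONeill1983, Ch. 3, Lemma 3.49] -/
def hessAt (f : E → ℝ) (x : E) : E →L[ℝ] E →L[ℝ] ℝ :=
  fderiv ℝ (fderiv ℝ f) x - (ContinuousLinearMap.compL ℝ E E ℝ (fderiv ℝ f x)).comp (chrAt G x)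

/-- Unfolding lemma: `Hess f (Y,Z) = D²f(Y,Z) − Df(Γ(Y,Z))`. [cite: ONeill1983, Ch. 3, Lemma 3.49] -/
@[simp]
theorem hessAt_apply (f : E → ℝ) (x Y Z : E) :
    hessAt G f x Y Z = fderiv ℝ (fderiv ℝ f) x Y Z - fderiv ℝ f x (chrAt G x Y Z) := by
  simp [hessAt]

/-- The **coordinate Laplace–Beltrami operator** `Δf = tr_G Hess f = g^{ij}(∂ᵢ∂ⱼf − Γᵏᵢⱼ ∂ₖ f)`
(O'Neill 1983, Ch. 3, Def. 3.50 ff.; Topping 2006, §2.1: `Δ = tr ∇²`). [cite: ONeill1983, Ch. 3, Def. 3.50] -/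
def lapAt [FiniteDimensional ℝ E] (f : E → ℝ) (x : E) : ℝ :=
  mtrAt G x (hessAt G f x)

/-- `Δf = Σ g^{kl} Hess f (b_k, b_l)` in a basis. [cite: ONeill1983, Ch. 3, Def. 3.50] -/
theorem lapAt_eq_sum {ι : Type*} [Fintype ι] [FiniteDimensional ℝ E] (b : Basis ι ℝ E)
    (f : E → ℝ) (x : E) :
    lapAt G f x = ∑ k, ∑ l, ginv G b x k l *
      (fderiv ℝ (fderiv ℝ f) x (b k) (b l) - fderiv ℝ f x (chrAt G x (b k) (b l))) := by
  rw [lapAt, mtrAt_eq_sum b]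
  simp only [hessAt_apply]

end Hessian

/-! ### Algebraic helpers on `cov₂At` and traces -/

section Helpers

variable {G : E → E →L[ℝ] E →L[ℝ] ℝ} {x : E}

/-- `cov₂At` only depends on the germ of the field at `x`. [folklore] -/
theorem cov₂At_congr {β₁ β₂ : E → E →L[ℝ] E →L[ℝ] ℝ} (h : β₁ =ᶠ[𝓝 x] β₂) :
    cov₂At G β₁ x = cov₂At G β₂ x := by
  ext W Y Z
  simp only [cov₂At_apply, h.fderiv_eq, h.self_of_nhds]

/-- `∇(c β) = c ∇β`. [folklore] -/
theorem cov₂At_const_smul {β : E → E →L[ℝ] E →L[ℝ] ℝ} (hβ : DifferentiableAt ℝ β x) (c : ℝ) :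
    cov₂At G (fun y ↦ c • β y) x = c • cov₂At G β x := by
  ext W Y Z
  simp only [cov₂At_apply, fderiv_fun_const_smul hβ, _root_.smul_apply, smul_eq_mul]
  ring

/-- The covariant derivative of a field of symmetric forms is symmetric in its last two slots.
[folklore] -/
theorem cov₂At_symm {β : E → E →L[ℝ] E →L[ℝ] ℝ} (hβ : DifferentiableAt ℝ β x)
    (hs : ∀ᶠ y in 𝓝 x, ∀ v w, β y v w = β y w v) (W Y Z : E) :
    cov₂At G β x W Y Z = cov₂At G β x W Z Y := by
  simp only [cov₂At_apply]
  have h1 : fderiv ℝ β x W Y Z = fderiv ℝ β x W Z Y := by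
    rw [← fderiv_clm_apply_const hβ Y W, ← fderiv_clm_apply_const hβ Z W,
      ← fderiv_clm_apply_const (differentiableAt_clm_apply_const hβ Y) Z W,
      ← fderiv_clm_apply_const (differentiableAt_clm_apply_const hβ Z) Y W]
    have heq : (fun y ↦ β y Y Z) =ᶠ[𝓝 x] fun y ↦ β y Z Y := hs.mono fun y hy ↦ hy Y Z
    rw [heq.fderiv_eq]
  rw [h1, hs.self_of_nhds (chrAt G x W Y) Z, hs.self_of_nhds Y (chrAt G x W Z)]
  ring

variable {ι : Type*} [Fintype ι] [FiniteDimensional ℝ E] (b : Basis ι ℝ E)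

/-- `tr (A ∘ B) = tr (B ∘ A)` in the basis, for continuous endomorphisms. [folklore] -/
theorem sum_coord_comp_comm (A B : E →L[ℝ] E) :
    ∑ i, b.coord i (A (B (b i))) = ∑ i, b.coord i (B (A (b i))) := by
  have h := LinearMap.trace_comp_comm' (B : E →ₗ[ℝ] E) (A : E →ₗ[ℝ] E)
  rw [trace_eq_sum_coord b, trace_eq_sum_coord b] at h
  simpa using h

omit [FiniteDimensional ℝ E] in
/-- Reindexing a threefold sum: move the innermost index outside. [folklore] -/
theorem sum_comm₃ (f : ι → ι → ι → ℝ) : ∑ k, ∑ l, ∑ i, f k l i = ∑ i, ∑ k, ∑ l, f k l i := by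
  calc ∑ k, ∑ l, ∑ i, f k l i = ∑ k, ∑ i, ∑ l, f k l i := Finset.sum_congr rfl fun k _ ↦ Finset.sum_comm
    _ = ∑ i, ∑ k, ∑ l, f k l i := Finset.sum_comm

end Helpers

/-! ### The variation of the scalar curvature in a basis (Topping, Prop. 2.3.6 for `Ric`) -/

namespace IsMetricFamilyOn

variable {ι : Type*} [Fintype ι] [FiniteDimensional ℝ E] [CompleteSpace E]
  {G : ℝ → E → E →L[ℝ] E →L[ℝ] ℝ} {S : Set ℝ} {V : Set E} {x : E} {t : ℝ} (b : Basis ι ℝ E)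

omit [Fintype ι] in
/-- `∂_t g^{kl} = bᵏ((−♯ h ♯) bˡ)`: the inverse metric coefficients are differentiable in `t`
within `S` (Topping 2006, §2.3.2). [cite: Topping2006, Prop. 2.3.6] -/
theorem hasDerivWithinAt_ginv (hG : IsMetricFamilyOn G S V) (hx : x ∈ V) (ht : t ∈ S) (k l : ι) :
    HasDerivWithinAt (fun s ↦ ginv (G s) b x k l)
      (b.coord k (-(sharpAt (G t) x (tDeriv G S t x (sharpAt (G t) x (coordCLM b l)))))) S t := by
  have h1 := (hG.hasDerivWithinAt_sharpAt hx ht).clm_apply (hasDerivWithinAt_const t S (coordCLM b l))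
  simp only [map_zero, add_zero] at h1
  have h2 := (coordCLM b k).hasFDerivAt.comp_hasDerivWithinAt t h1
  simpa [ginv, Function.comp_def] using h2

/-- `∂_t Ric(Y,Z) = Σᵢ bⁱ((∂_t R)(bᵢ,Y)Z)` within `S` (the trace commutes with `∂_t`).
[cite: Topping2006, Prop. 2.3.6] -/
theorem hasDerivWithinAt_ricAt_apply (hG : IsMetricFamilyOn G S V) (hx : x ∈ V) (ht : t ∈ S)
    (Y Z : E) :
    HasDerivWithinAt (fun s ↦ ricAt (G s) x Y Z)
      (∑ i, b.coord i (varRiemAt G S t x (b i) Y Z)) S t := by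
  have heq : (fun s ↦ ricAt (G s) x Y Z) = fun s ↦ ∑ i, coordCLM b i (riemAt (G s) x (b i) Y Z) :=
    funext fun s ↦ ricAt_eq_sum_coord b Y Z
  rw [heq]
  have hs : HasDerivWithinAt (fun s ↦ ∑ i, coordCLM b i (riemAt (G s) x (b i) Y Z))
      (∑ i, coordCLM b i (varRiemAt G S t x (b i) Y Z)) S t :=
    HasDerivWithinAt.fun_sum fun i _ ↦
      (coordCLM b i).hasFDerivAt.comp_hasDerivWithinAt t (hG.hasDerivWithinAt_riemAt_apply hx ht (b i) Y Z)
  simpa using hs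

/-- **The variation of the scalar curvature in a basis** (Topping 2006, Prop. 2.3.6 with
`α = Ric`: `∂_t tr α = −⟨h, α⟩ + tr ∂_t α`): within `S`,
`∂_t S = Σ_{kl} ∂_t g^{kl} Ric_{kl} + Σ_{kl} g^{kl} Σᵢ bⁱ((∂_t R)(bᵢ,b_k)b_l)`.
[cite: Topping2006, Prop. 2.3.6] -/
theorem hasDerivWithinAt_scalAt (hG : IsMetricFamilyOn G S V) (hx : x ∈ V) (ht : t ∈ S) :
    HasDerivWithinAt (fun s ↦ scalAt (G s) x)
      (∑ k, ∑ l, (b.coord k (-(sharpAt (G t) x (tDeriv G S t x (sharpAt (G t) x (coordCLM b l)))))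
          * ricAt (G t) x (b k) (b l)
        + ginv (G t) b x k l * ∑ i, b.coord i (varRiemAt G S t x (b i) (b k) (b l)))) S t := by
  have heq : (fun s ↦ scalAt (G s) x) = fun s ↦ ∑ k, ∑ l, ginv (G s) b x k l * ricAt (G s) x (b k) (b l) :=
    funext fun s ↦ scalAt_eq_sum b
  rw [heq]
  exact HasDerivWithinAt.fun_sum fun k _ ↦ HasDerivWithinAt.fun_sum fun l _ ↦
    (hG.hasDerivWithinAt_ginv b hx ht k l).mul (hG.hasDerivWithinAt_ricAt_apply b hx ht (b k) (b l))

/-! ### The Ricci flow in coordinates: `h = −2 Ric` -/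

section RicciFlow

variable (hG : IsMetricFamilyOn G S V)
  (hfl : ∀ s ∈ S, ∀ y ∈ V, tDeriv G S s y = (-2 : ℝ) • ricAt (G s) y)
include hG hfl

omit [Fintype ι] in
/-- Under the flow, `∇h = −2 ∇Ric` on `V`. [cite: Topping2006, Prop. 2.5.4] -/
theorem cov₂At_tDeriv_of_flow (ht : t ∈ S) {y : E} (hy : y ∈ V) :
    cov₂At (G t) (tDeriv G S t) y = (-2 : ℝ) • cov₂At (G t) (ricAt (G t)) y := by
  have heq : tDeriv G S t =ᶠ[𝓝 y] fun z ↦ (-2 : ℝ) • ricAt (G t) z :=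
    ((hG.isOpen ht).mem_nhds hy |> fun h ↦ Filter.eventually_of_mem h fun z hz ↦ hfl t ht z hz)
  rw [cov₂At_congr heq, cov₂At_const_smul ((hG.isMetricOn t ht).differentiableAt_ricAt hy)]

omit [Fintype ι] in
/-- **Prop. 2.3.1 under the flow**: `G(Π(X,Y), Z) = −[(∇_X Ric)(Y,Z) + (∇_Y Ric)(X,Z) − (∇_Z Ric)(X,Y)]`.
[cite: Topping2006, Prop. 2.3.1] -/
theorem apply_varChrAt_of_flow (ht : t ∈ S) {y : E} (hy : y ∈ V) (X Y Z : E) :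
    G t y (varChrAt G S t y X Y) Z =
      -(cov₂At (G t) (ricAt (G t)) y X Y Z + cov₂At (G t) (ricAt (G t)) y Y X Z
        - cov₂At (G t) (ricAt (G t)) y Z X Y) := by
  rw [hG.apply_varChrAt hy ht, hG.cov₂At_tDeriv_of_flow hfl ht hy]
  simp only [_root_.smul_apply, smul_eq_mul]
  ring

/-- **The trace of `Π` vanishes under the flow** (contracted Bianchi identity):
`Σ_{kl} g^{kl} Π(b_k, b_l) = 0` on `V`, since `G(Σ g^{kl}Π(b_k,b_l), Z) = −2 div Ric(Z) + dS(Z) = 0`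
(Topping 2006, proof of Prop. 2.3.9: the term `δ²h` with `δ Ric = −½ dR`).
[cite: Topping2006, Prop. 2.3.9] -/
theorem sum_ginv_smul_varChrAt_eq_zero (ht : t ∈ S) {y : E} (hy : y ∈ V) :
    ∑ k, ∑ l, ginv (G t) b y k l • varChrAt G S t y (b k) (b l) = 0 := by
  have hGt := hG.isMetricOn t ht
  have hi := hGt.isInvertible y hy
  -- pair with an arbitrary `Z`
  have hpair : ∀ Z, G t y (∑ k, ∑ l, ginv (G t) b y k l • varChrAt G S t y (b k) (b l)) Z = 0 := by
    intro Z
    simp only [map_sum, map_smul, FunLike.coe_sum, Finset.sum_apply, _root_.smul_apply, smul_eq_mul,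
      hG.apply_varChrAt_of_flow hfl ht hy]
    -- the three contractions of `∇Ric`
    have h1 : fderiv ℝ (scalAt (G t)) y Z =
        2 * ∑ k, ∑ l, ginv (G t) b y k l * cov₂At (G t) (ricAt (G t)) y (b k) (b l) Z :=
      hGt.fderiv_scalAt' b hy Z
    have h2 : ∑ k, ∑ l, ginv (G t) b y k l * cov₂At (G t) (ricAt (G t)) y (b l) (b k) Z =
        ∑ k, ∑ l, ginv (G t) b y k l * cov₂At (G t) (ricAt (G t)) y (b k) (b l) Z := by
      rw [Finset.sum_comm]
      refine Finset.sum_congr rfl fun k _ ↦ Finset.sum_congr rfl fun l _ ↦ ?_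
      rw [ginv_comm b hi (hGt.symm y hy) l k]
    have h3 : ∑ k, ∑ l, ginv (G t) b y k l * cov₂At (G t) (ricAt (G t)) y Z (b k) (b l) =
        fderiv ℝ (scalAt (G t)) y Z := by
      rw [hGt.fderiv_scalAt_eq_mtrAt hy Z, mtrAt_eq_sum b]
    have hsplit : ∑ k, ∑ l, ginv (G t) b y k l *
        -(cov₂At (G t) (ricAt (G t)) y (b k) (b l) Z + cov₂At (G t) (ricAt (G t)) y (b l) (b k) Z
          - cov₂At (G t) (ricAt (G t)) y Z (b k) (b l)) =
        -(∑ k, ∑ l, ginv (G t) b y k l * cov₂At (G t) (ricAt (G t)) y (b k) (b l) Z)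
        - (∑ k, ∑ l, ginv (G t) b y k l * cov₂At (G t) (ricAt (G t)) y (b l) (b k) Z)
        + ∑ k, ∑ l, ginv (G t) b y k l * cov₂At (G t) (ricAt (G t)) y Z (b k) (b l) := by
      simp only [mul_neg, mul_add, mul_sub, Finset.sum_neg_distrib, Finset.sum_add_distrib,
        Finset.sum_sub_distrib]
      ring
    rw [hsplit, h2, h3, h1]
    ring
  -- nondegeneracy
  have h0 : G t y (∑ k, ∑ l, ginv (G t) b y k l • varChrAt G S t y (b k) (b l)) = 0 := by
    ext Z; exact hpair Z
  rw [← sharpAt_apply hi (∑ k, ∑ l, ginv (G t) b y k l • varChrAt G S t y (b k) (b l)), h0, map_zero]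

/-- **`tr_X Π(X, Z) = −dS(Z)` under the flow**: `Σᵢ bⁱ(Π(bᵢ, Z)) = −∂_Z S` on `V`
(Topping 2006, proof of Prop. 2.3.9: `tr Π(·,Z) = ½ d(tr h)(Z)` with `tr h = −2S`).
[cite: Topping2006, Prop. 2.3.9] -/
theorem sum_coord_varChrAt_eq (ht : t ∈ S) {y : E} (hy : y ∈ V) (Z : E) :
    ∑ i, b.coord i (varChrAt G S t y (b i) Z) = -fderiv ℝ (scalAt (G t)) y Z := by
  have hGt := hG.isMetricOn t ht
  have hi := hGt.isInvertible y hy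
  have hRs : ∀ᶠ z in 𝓝 y, ∀ v w, ricAt (G t) z v w = ricAt (G t) z w v :=
    ((hG.isOpen ht).mem_nhds hy |> fun h ↦ Filter.eventually_of_mem h fun z hz ↦ hGt.ricAt_comm hz)
  have hsym : ∀ W Y Z', cov₂At (G t) (ricAt (G t)) y W Y Z' = cov₂At (G t) (ricAt (G t)) y W Z' Y :=
    cov₂At_symm (hGt.differentiableAt_ricAt hy) hRs
  -- expand `bⁱ(Π(bᵢ,Z)) = Σⱼ g^{ij} G(Π(bᵢ,Z), bⱼ)`
  have hexp : ∑ i, b.coord i (varChrAt G S t y (b i) Z) =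
      -(∑ i, ∑ j, ginv (G t) b y i j * cov₂At (G t) (ricAt (G t)) y (b i) Z (b j))
      - (∑ i, ∑ j, ginv (G t) b y i j * cov₂At (G t) (ricAt (G t)) y Z (b i) (b j))
      + ∑ i, ∑ j, ginv (G t) b y i j * cov₂At (G t) (ricAt (G t)) y (b j) (b i) Z := by
    simp only [coord_eq_sum_ginv b hi, hG.apply_varChrAt_of_flow hfl ht hy,
      mul_neg, mul_add, mul_sub, Finset.sum_neg_distrib, Finset.sum_add_distrib, Finset.sum_sub_distrib]
    ring
  have h13 : ∑ i, ∑ j, ginv (G t) b y i j * cov₂At (G t) (ricAt (G t)) y (b j) (b i) Z =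
      ∑ i, ∑ j, ginv (G t) b y i j * cov₂At (G t) (ricAt (G t)) y (b i) Z (b j) := by
    rw [Finset.sum_comm]
    refine Finset.sum_congr rfl fun i _ ↦ Finset.sum_congr rfl fun j _ ↦ ?_
    rw [ginv_comm b hi (hGt.symm y hy) j i, hsym (b i) Z (b j)]
  have h2 : ∑ i, ∑ j, ginv (G t) b y i j * cov₂At (G t) (ricAt (G t)) y Z (b i) (b j) =
      fderiv ℝ (scalAt (G t)) y Z := by
    rw [hGt.fderiv_scalAt_eq_mtrAt hy Z, mtrAt_eq_sum b]
  rw [hexp, h13, h2]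
  ring

/-- **The `div`-term vanishes under the flow**: for every functional `φ` and direction `X`,
`Σ_{kl} g^{kl} [φ(D_XΠ(b_k,b_l)) − φ(Π(Γ(X,b_k),b_l)) − φ(Π(b_k,Γ(X,b_l)))] = 0`, i.e.
`φ((∇_X tr_G Π)) − φ(Γ_X tr_G Π) = ∂_X φ(tr_G Π) = 0` (metric traces commute with `∇`, and
`tr_G Π = 0` identically on `V`). [cite: Topping2006, Prop. 2.3.9] -/
theorem sum_ginv_fderiv_varChrAt_eq_zero (hx : x ∈ V) (ht : t ∈ S) (φ : E →L[ℝ] ℝ) (X : E) :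
    ∑ k, ∑ l, ginv (G t) b x k l * (φ (fderiv ℝ (varChrAt G S t) x X (b k) (b l))
      - φ (varChrAt G S t x (chrAt (G t) x X (b k)) (b l))
      - φ (varChrAt G S t x (b k) (chrAt (G t) x X (b l)))) = 0 := by
  have hGt := hG.isMetricOn t ht
  have hPd := hG.differentiableAt_varChrAt hx ht
  -- the scalar field of bilinear forms `β_φ = φ ∘ Π`
  set β : E → E →L[ℝ] E →L[ℝ] ℝ := fun y ↦
    (ContinuousLinearMap.compL ℝ E E ℝ φ).comp (varChrAt G S t y) with hβ
  have hβapp : ∀ y Y Z, β y Y Z = φ (varChrAt G S t y Y Z) := fun y Y Z ↦ rfl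
  have hβd : HasFDerivAt β ((ContinuousLinearMap.compL ℝ E (E →L[ℝ] E) (E →L[ℝ] ℝ)
      (ContinuousLinearMap.compL ℝ E E ℝ φ)).comp (fderiv ℝ (varChrAt G S t) x)) x :=
    (ContinuousLinearMap.compL ℝ E (E →L[ℝ] E) (E →L[ℝ] ℝ)
      (ContinuousLinearMap.compL ℝ E E ℝ φ)).hasFDerivAt.comp x hPd.hasFDerivAt
  have hDβ : ∀ Y Z, fderiv ℝ β x X Y Z = φ (fderiv ℝ (varChrAt G S t) x X Y Z) := by
    intro Y Z; rw [hβd.fderiv]; rfl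
  -- its metric trace is `φ (tr_G Π) = 0` near `x`
  have htr0 : (fun y ↦ mtrAt (G t) y (β y)) =ᶠ[𝓝 x] fun _ ↦ (0 : ℝ) := by
    filter_upwards [(hG.isOpen ht).mem_nhds hx] with y hy
    rw [mtrAt_eq_sum b]
    have h0 := congrArg φ (hG.sum_ginv_smul_varChrAt_eq_zero b hfl ht hy)
    rw [map_zero, map_sum] at h0
    rw [← h0]
    refine Finset.sum_congr rfl fun k _ ↦ ?_
    rw [map_sum]
    refine Finset.sum_congr rfl fun l _ ↦ ?_
    rw [map_smul, smul_eq_mul, hβapp]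
  have hD0 : fderiv ℝ (fun y ↦ mtrAt (G t) y (β y)) x X = 0 := by
    rw [htr0.fderiv_eq, fderiv_fun_const]; rfl
  rw [hGt.fderiv_mtrAt hx hβd.differentiableAt X, mtrAt_eq_sum b] at hD0
  simp only [cov₂At_apply, hDβ, hβapp] at hD0
  exact hD0

/-- **The first (`div`) trace of `∂_t Ric` vanishes under the flow**:
`Σ_{kl} g^{kl} Σᵢ bⁱ((∇_{bᵢ}Π)(b_k) b_l) = 0`. [cite: Topping2006, Prop. 2.3.9] -/
theorem termA_eq_zero (hx : x ∈ V) (ht : t ∈ S) :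
    ∑ k, ∑ l, ginv (G t) b x k l * ∑ i, b.coord i
      (fderiv ℝ (varChrAt G S t) x (b i) (b k) (b l)
        + chrAt (G t) x (b i) (varChrAt G S t x (b k) (b l))
        - varChrAt G S t x (chrAt (G t) x (b i) (b k)) (b l)
        - varChrAt G S t x (b k) (chrAt (G t) x (b i) (b l))) = 0 := by
  have hV0 := hG.sum_ginv_smul_varChrAt_eq_zero b hfl ht hx
  have hstar := fun i ↦ hG.sum_ginv_fderiv_varChrAt_eq_zero b hfl hx ht (coordCLM b i) (b i)
  simp only [coordCLM_apply] at hstar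
  -- the `Γ` term: `Σ_{kl} g^{kl} bⁱ(Γᵢ Π(b_k,b_l)) = bⁱ(Γᵢ (tr_G Π)) = 0`
  have hΓ : ∀ i, ∑ k, ∑ l, ginv (G t) b x k l *
      b.coord i (chrAt (G t) x (b i) (varChrAt G S t x (b k) (b l))) = 0 := by
    intro i
    have h := congrArg (fun v ↦ b.coord i (chrAt (G t) x (b i) v)) hV0
    simp only [map_sum, map_smul, map_zero, smul_eq_mul] at h
    exact h
  -- reorganise the sums
  calc ∑ k, ∑ l, ginv (G t) b x k l * ∑ i, b.coord i
        (fderiv ℝ (varChrAt G S t) x (b i) (b k) (b l)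
          + chrAt (G t) x (b i) (varChrAt G S t x (b k) (b l))
          - varChrAt G S t x (chrAt (G t) x (b i) (b k)) (b l)
          - varChrAt G S t x (b k) (chrAt (G t) x (b i) (b l)))
      = ∑ i, (∑ k, ∑ l, ginv (G t) b x k l * (b.coord i (fderiv ℝ (varChrAt G S t) x (b i) (b k) (b l))
          - b.coord i (varChrAt G S t x (chrAt (G t) x (b i) (b k)) (b l))
          - b.coord i (varChrAt G S t x (b k) (chrAt (G t) x (b i) (b l))))
        + ∑ k, ∑ l, ginv (G t) b x k l *
            b.coord i (chrAt (G t) x (b i) (varChrAt G S t x (b k) (b l)))) := by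
        simp only [map_add, map_sub, Finset.mul_sum, mul_add, mul_sub]
        rw [sum_comm₃]
        refine Finset.sum_congr rfl fun i _ ↦ ?_
        rw [← Finset.sum_add_distrib]
        refine Finset.sum_congr rfl fun k _ ↦ ?_
        rw [← Finset.sum_add_distrib]
        refine Finset.sum_congr rfl fun l _ ↦ ?_
        ring
    _ = 0 := by simp only [hstar, hΓ, add_zero, Finset.sum_const_zero]

/-- **The second trace of `∂_t Ric` is `−ΔS` under the flow**:
`Σ_{kl} g^{kl} Σᵢ bⁱ((∇_{b_k}Π)(bᵢ) b_l) = −ΔS` (`tr Π(·,Z) = −dS(Z)`, so the trace is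
`tr_G ∇(−dS) = −tr_G Hess S`; Topping 2006, (2.3.16)). [cite: Topping2006, Prop. 2.3.9] -/
theorem termB_eq (hx : x ∈ V) (ht : t ∈ S) :
    ∑ k, ∑ l, ginv (G t) b x k l * ∑ i, b.coord i
      (fderiv ℝ (varChrAt G S t) x (b k) (b i) (b l)
        + chrAt (G t) x (b k) (varChrAt G S t x (b i) (b l))
        - varChrAt G S t x (chrAt (G t) x (b k) (b i)) (b l)
        - varChrAt G S t x (b i) (chrAt (G t) x (b k) (b l))) = -lapAt (G t) (scalAt (G t)) x := by
  have hGt := hG.isMetricOn t ht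
  have hPd := hG.differentiableAt_varChrAt hx ht
  have hSc : ContDiffAt ℝ ∞ (scalAt (G t)) x := hGt.contDiffAt_scalAt hx
  have hdS : DifferentiableAt ℝ (fderiv ℝ (scalAt (G t))) x :=
    (hSc.fderiv_right (m := ∞) (by simp)).differentiableAt (by simp)
  -- `ω(y)(Z) = Σᵢ bⁱ(Π_y(bᵢ, Z)) = −dS_y(Z)` near `x`
  have hω : ∀ Z, (fun y ↦ ∑ i, b.coord i (varChrAt G S t y (b i) Z)) =ᶠ[𝓝 x]
      fun y ↦ -fderiv ℝ (scalAt (G t)) y Z := fun Z ↦ by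
    filter_upwards [(hG.isOpen ht).mem_nhds hx] with y hy
    exact hG.sum_coord_varChrAt_eq b hfl ht hy Z
  -- (1) the `DΠ` term: `Σᵢ bⁱ(D_{b_k}Π(bᵢ,b_l)) = ∂_{b_k} ω(·)(b_l) = −D²S(b_k, b_l)`
  have h1 : ∀ k l, ∑ i, b.coord i (fderiv ℝ (varChrAt G S t) x (b k) (b i) (b l)) =
      -fderiv ℝ (fderiv ℝ (scalAt (G t))) x (b k) (b l) := by
    intro k l
    have hdiff : ∀ i, DifferentiableAt ℝ (fun y ↦ varChrAt G S t y (b i) (b l)) x := fun i ↦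
      differentiableAt_clm_apply_const (differentiableAt_clm_apply_const hPd (b i)) (b l)
    have hsum : fderiv ℝ (fun y ↦ ∑ i, b.coord i (varChrAt G S t y (b i) (b l))) x (b k) =
        ∑ i, b.coord i (fderiv ℝ (varChrAt G S t) x (b k) (b i) (b l)) := by
      have hs : HasFDerivAt (fun y ↦ ∑ i, coordCLM b i (varChrAt G S t y (b i) (b l)))
          (∑ i, (coordCLM b i).comp (fderiv ℝ (fun y ↦ varChrAt G S t y (b i) (b l)) x)) x :=
        HasFDerivAt.fun_sum fun i _ ↦ (coordCLM b i).hasFDerivAt.comp x (hdiff i).hasFDerivAt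
      simp only [coordCLM_apply] at hs
      rw [hs.fderiv, FunLike.coe_sum, Finset.sum_apply]
      refine Finset.sum_congr rfl fun i _ ↦ ?_
      rw [ContinuousLinearMap.comp_apply, coordCLM_apply,
        fderiv_clm_apply_const (differentiableAt_clm_apply_const hPd (b i)) (b l) (b k),
        fderiv_clm_apply_const hPd (b i) (b k)]
    rw [← hsum, (hω (b l)).fderiv_eq, fderiv_fun_neg, _root_.neg_apply,
      fderiv_clm_apply_const hdS (b l) (b k)]
  -- (2) the `Γ ∘ Π` and `Π ∘ Γ` terms cancel (trace of a commutator)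
  have h2 : ∀ k l, ∑ i, b.coord i (chrAt (G t) x (b k) (varChrAt G S t x (b i) (b l))) =
      ∑ i, b.coord i (varChrAt G S t x (chrAt (G t) x (b k) (b i)) (b l)) := fun k l ↦
    sum_coord_comp_comm b (chrAt (G t) x (b k)) ((varChrAt G S t x).flip (b l))
  -- (3) the last term: `Σᵢ bⁱ(Π(bᵢ, Γ(b_k,b_l))) = −dS(Γ(b_k,b_l))`
  have h3 : ∀ k l, ∑ i, b.coord i (varChrAt G S t x (b i) (chrAt (G t) x (b k) (b l))) =
      -fderiv ℝ (scalAt (G t)) x (chrAt (G t) x (b k) (b l)) := fun k l ↦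
    hG.sum_coord_varChrAt_eq b hfl ht hx _
  rw [lapAt_eq_sum (G t) b, ← Finset.sum_neg_distrib]
  refine Finset.sum_congr rfl fun k _ ↦ ?_
  rw [← Finset.sum_neg_distrib]
  refine Finset.sum_congr rfl fun l _ ↦ ?_
  simp only [map_add, map_sub, Finset.sum_add_distrib, Finset.sum_sub_distrib, h1, h2, h3]
  ring

/-- **The `−⟨h, Ric⟩` term is `2|Ric|²` under the flow**:
`Σ_{kl} (∂_t g^{kl}) Ric_{kl} = 2 tr((♯Ric)²) = 2 |Ric|²`. [cite: Topping2006, Prop. 2.5.4] -/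
theorem sum_dginv_ricAt_eq (hx : x ∈ V) (ht : t ∈ S) :
    ∑ k, ∑ l, b.coord k (-(sharpAt (G t) x (tDeriv G S t x (sharpAt (G t) x (coordCLM b l)))))
      * ricAt (G t) x (b k) (b l) = 2 * normSqAt (G t) x (ricAt (G t) x) := by
  have hGt := hG.isMetricOn t ht
  set Sh := sharpAt (G t) x with hSh
  set R := ricAt (G t) x with hR
  have hflip : R.flip = R := by
    ext v w; exact hGt.ricAt_comm hx w v
  rw [hfl t ht x hx, normSqAt_eq_traceCLM, traceCLM_apply, trace_eq_sum_coord b, hflip, Finset.mul_sum]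
  refine Finset.sum_congr rfl fun k _ ↦ ?_
  -- `Σ_l bᵏ(2 ♯R♯ bˡ) R(b_k,b_l) = bᵏ(2 ♯R♯ (R b_k))`
  have hRk : R (b k) = ∑ l, R (b k) (b l) • coordCLM b l := eq_sum_smul_coordCLM b (R (b k))
  rw [← hR, ← hSh]
  simp only [_root_.smul_apply, map_smul, map_neg, smul_eq_mul, ContinuousLinearMap.coe_coe,
    ContinuousLinearMap.comp_apply]
  conv_rhs => rw [hRk]
  simp only [map_sum, map_smul, smul_eq_mul, Finset.mul_sum]
  refine Finset.sum_congr rfl fun l _ ↦ ?_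
  ring

/-- **Topping 2006, Prop. 2.5.4, in coordinates (evolution of the scalar curvature under the
Ricci flow).** Let `G` be a smooth one-parameter family of metric components on `V × S`
(`IsMetricFamilyOn`) satisfying the Ricci flow equation in coordinates, `∂G/∂t = −2 Ric(G)` on
`V × S`. Then at every `t ∈ S`, `x ∈ V` the scalar curvature `s ↦ S(G s)(x)` is differentiable
within `S` with derivative `ΔS + 2|Ric|²` (coordinate Laplacian `lapAt` and metric square norm
`normSqAt` of `G t` at `x`): `∂R/∂t = ΔR + 2|Ric|²` (Topping 2006, (2.5.5); Hamilton 1982,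
Cor. 7.5). [cite: Topping2006, Prop. 2.5.4] -/
theorem hasDerivWithinAt_scalAt_ricciFlow (hx : x ∈ V) (ht : t ∈ S) :
    HasDerivWithinAt (fun s ↦ scalAt (G s) x)
      (lapAt (G t) (scalAt (G t)) x + 2 * normSqAt (G t) x (ricAt (G t) x)) S t := by
  have hGt := hG.isMetricOn t ht
  set b := Module.finBasis ℝ E
  have hd := hG.hasDerivWithinAt_scalAt b hx ht
  refine hd.congr_deriv ?_
  rw [Finset.sum_congr rfl fun k _ ↦ Finset.sum_add_distrib, Finset.sum_add_distrib,
    hG.sum_dginv_ricAt_eq b hfl hx ht]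
  -- the `tr_G ∂_t Ric` term: expand `varRiemAt` into the two traces
  have hA := hG.termA_eq_zero b hfl hx ht
  have hB := hG.termB_eq b hfl hx ht
  have hc := hGt.chrAt_comm hx
  have hsplit : ∑ k, ∑ l, ginv (G t) b x k l * ∑ i, b.coord i (varRiemAt G S t x (b i) (b k) (b l)) =
      (∑ k, ∑ l, ginv (G t) b x k l * ∑ i, b.coord i
        (fderiv ℝ (varChrAt G S t) x (b i) (b k) (b l)
          + chrAt (G t) x (b i) (varChrAt G S t x (b k) (b l))
          - varChrAt G S t x (chrAt (G t) x (b i) (b k)) (b l)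
          - varChrAt G S t x (b k) (chrAt (G t) x (b i) (b l))))
      - ∑ k, ∑ l, ginv (G t) b x k l * ∑ i, b.coord i
        (fderiv ℝ (varChrAt G S t) x (b k) (b i) (b l)
          + chrAt (G t) x (b k) (varChrAt G S t x (b i) (b l))
          - varChrAt G S t x (chrAt (G t) x (b k) (b i)) (b l)
          - varChrAt G S t x (b i) (chrAt (G t) x (b k) (b l))) := by
    rw [← Finset.sum_sub_distrib]
    refine Finset.sum_congr rfl fun k _ ↦ ?_
    rw [← Finset.sum_sub_distrib]
    refine Finset.sum_congr rfl fun l _ ↦ ?_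
    rw [← mul_sub, ← Finset.sum_sub_distrib]
    congr 1
    refine Finset.sum_congr rfl fun i _ ↦ ?_
    rw [← map_sub]
    congr 1
    simp only [varRiemAt_apply, hc (b k) (b i)]
    abel
  rw [hsplit, hA, hB]
  ring

end RicciFlow

end IsMetricFamilyOn

end MetricCoord

end Literature.Geometry.Lorentzian

end
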